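import Summits.QuantumFields.YangMills.Theorems.BalabanUVNodesN21GappedTopCut13CoPHCount
import Summits.QuantumFields.YangMills.Theorems.BalabanUVNodesN21SelectedTopCut13CoPHRecord

/-!
# N21 (NE7c) · THE GAPPED TOP CUT AT THE `CoPH`-KEYED STAGE-13 RECORD: for the two runs OF RECORD of a comparison `K` (n20-d's `runA₁₃ ∕ runB₁₃ ∕ histA₁₃ ∕ histB₁₃`, tops
# `K₀ + K` and `K₀ + K + 1`) on the live-selector line, ONE COMMON DEPTH `i ≤ n` whose TWO-SIDED collar shells weigh at most `4(2L^m)⁴∕(n+1) ×` the runs' partition sums —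
# rows: the live-selector pin, (H-ζ) and the sign rows `0 ≤ ρ ≤ 1`, `0 ≤ ε_top` ONLY ((M1)-FREE NE7c for the top-lettered terms of record, BOTH sides of the cut)

R134 seat `pub-ymgap-dag-n21-d` (g11), node N21 = NE7c (NOT PRINTED; NOT proved at print's fixed thresholds), strategy s2; lane K3⁷ `SpineGivenEndpointR13SepCoPH`
(stmt-QuantumFields-20544, `--supports … --as helper`; COUNT-NEUTRAL).  Imports `…N21GappedTopCut13CoPHCount` (§32–§34) and T3 `…N21SelectedTopCut13CoPHRecord` (p608066: E1∕E2 for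
the top-lettered terms of record `sum_topClassWeightAt_runA∕B_eq_schemeZ_of_liveSel`; through it g9's `integrable_chi_mul_dressedSlots_of_ppSelLive` and (POS)-ζ `zetaOfRecord_nonneg`).

WHAT THIS FILE PROVES (theorems only; 0 `def`, 0 `sorry`).
* §35 ★★★ `exists_common_depth_topGapShell_le_of_liveSel` — at a `CoPH`-keyed Stage-13 tuple `(F, θ, hP, g₀, os)` on the LIVE-SELECTOR LINE (`hsel`), under (H-ζ), for every offset
  `K₀`, comparison `K` with both tops positive (`kA + 1 = K₀ + K`, `kB + 1 = K₀ + K + 1`), width `0 ≤ ρ ≤ 1`, both tops' `ε ≥ 0`, depth budget `n` and source `t`: SOME `i ≤ n` has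
  `Σ_{s′} gapShell^A(θ^A_{i+2}, θ^A_{i+1}, θ^A_i) ≤ (4(2L^m)⁴∕(n+1))·Σ_s classWeight^A_{kA}(s)` AND the same for run B, `θ^X_i = ε^X_{top}(1 − ρ)^i`.
* §35 ★★★ `exists_common_depth_topGapShell_le_topClassWeight_of_liveSel` — the same common depth with the bounds RELATIVE TO THE TOP-LETTERED TERMS THEMSELVES at the selected
  middle letter `θ_{i+1}`: `Σ_{s′} gapShell^X_i ≤ (4(2L^m)⁴∕(n+1))·Σ_{s′} topClassWeight^X(θ^X_{i+1})(s′)`, `X = A, B` (T3's E1∕E2: both sums are the run's partition function) — the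
  `left ∕ right` fields of `T4IndicatorShell.ShellWeightBound` for a top-lettered reading whose shells are the TWO-SIDED collars, (M1)-FREE; with `Σ_K 1∕(n_K+1) < ∞` summable.
* §35 `topGapShellAt_nonneg_of_liveSel`, `topGapShellAt_le_topClassWeightAt_of_liveSel` — the `sh_nonneg ∕ sh_le` clauses at the record's rows.

WHY THE TWO-SIDED COLLAR (LOCATED against this seat's own ROAD-S, g10 R1–R4; see the definition lane's header): `T4IndicatorShell`'s design (i) sends BOTH mixed indicator
pieces to the bad class and dominates them, under sup-closeness `|u^A − u^B| ≤ Δ`, by single-run shells on BOTH sides of the cut; for `Δ ≤` both gaps `θ_{i+1}ρ`, `θ_iρ` the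
single-run gapped core is pointwise below the common-refinement core, so design (i)'s shells are ≤ the gapped shells bounded here — that comparison (two-run site identification +
N16's sup-closeness) is the CONSUMER's (N19′ ∕ U5), NOT typed here.

HONEST FRAMING (binding).  Bookkeeping BY NAME; NO estimate of Bałaban's; only the top step's (2.17)∕(3.2) factor family is re-lettered (the (3.3) `b|_{2δ_k}` family and everything
below the top step are print's ∕ the record's — their two-run shells are LOCATED, not typed); the top 𝐑-step omitted as in T1 (integral-preserving); a keyed READING carrying these
shells and the K3 skeleton's `PinnedAtLive` admitting it are LOCATED (plan ∕ n20-d ∕ N19′), not typed here; NOT a bound at print's fixed thresholds ((M1) stands there, g9 FILES 2–7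
and the w-seats' chart road); no `Provisos₁₃CoPH` inhabitant claimed (K0⁷ open); NE7c NOT PRINTED ∕ NOT proved at print's thresholds; N21 NOT discharged; K3⁷ NOT claimed; counts
UNMOVED (typed 28∕28 · discharged 5∕27); never a count claim.  No `instance`, no `notation`, no `def`.  One finite four-torus programme at fixed `ε` — NOT ℝ⁴, NOT OS, NOT a mass
gap, NOT the Clay problem.
-/

noncomputable section

open scoped BigOperators
open Finset MeasureTheory

namespace Summit.QuantumFields.YangMills.Theorems.N21ShellSplitOfRecord13CoPH

open Literature.MathematicalPhysics.QuantumFieldTheory.Balaban1983to89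
open Literature.MathematicalPhysics.QuantumFieldTheory.Balaban1983to89.T4Continuum
open Literature.MathematicalPhysics.QuantumFieldTheory.Balaban1983to89.Node00
open YMDAG.UVSplit (runA₁₃ runB₁₃ histA₁₃ histB₁₃ histA₁₃_zero histB₁₃_zero)
open Summit.QuantumFields.YangMills.Theorems.N21StepWeightsPositivity (zetaOfRecord_nonneg)
open Summit.QuantumFields.YangMills.BalabanUVNodes.N19MGFFormAtRecordMass (sum_classWeightOfDatum₉_datumOfRecord₁₃CoPH_eq_schemeZ_of_ppSelLive)

/-! ## §35 The two runs of record on the live line: one common depth for the TWO-SIDED collars, rows = `hsel` + (H-ζ) + signs -/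

section Record

variable {F : T4Family} {N : ℕ} [NeZero N]

/-- (R) **`0 ≤` THE TWO-SIDED COLLAR SHELL OF A TOP HISTORY OF RUN A OF RECORD** on the live-selector line, in the meaningful regime (`θlo ≤ θ ≤ θhi`); rows `hsel`, (H-ζ) — the
`sh_nonneg_left` clause of `T4IndicatorShell.ShellWeightBound` for a reading carrying these shells. [bookkeeping] -/
theorem topGapShellAt_nonneg_of_liveSel (θ : Stage13HParams F N) (hP : θ.Provisos₁₃CoPH F N) (g₀ : ℕ → ℝ) (os : List (ULoop F))
    (E : B12.RunParams → ℝ) (hsel : θ.ppSel = ppSelLiveOfRecord F N θ.ν θ.τ9 E (wOfRecord₉ F N θ.toStage9Params)) (hζm : ZetaMeasurable F N θ.ζ)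
    (p : B12.RunParams) (k : ℕ) (hk : k + 1 = p.K) (hg : gOfRecord₁₃ F N θ.toStage13Params p 0 = g₀ p.K) {θlo θm θhi : ℝ} (hlo : θlo ≤ θm) (hhi : θm ≤ θhi)
    (t : ℝ) (s' : SeqOfRecord F θ.ν θ.τ9.M (gOfRecord₁₃ F N θ.toStage13Params p) p.K (k + 1)) :
    0 ≤ topGapShellAt F N θ.toStage9Params (datumOfRecord₁₃CoPH F N θ hP) g₀ os p (gOfRecord₁₃ F N θ.toStage13Params p) k θlo θm θhi t s' := by
  have hζ0 : ∀ p g k s Pl Ql RS U V', 0 ≤ θ.ζ p g k s Pl Ql RS U V' :=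
    fun p g k s Pl Ql RS U V' => zetaOfRecord_nonneg F N θ.ν θ.τ9.M hP.zetaUnity hP.zetaAbs p g k s Pl Ql RS U V'
  have hU : LocalBgMeasurable F N θ.ν := localBgMeasurable F N θ.ν
  have hD : (datumOfRecord₁₃CoPH F N θ hP).AvgMeasurable := (isPrintedAveraged_datumOfRecord₁₃CoPH F N θ hP).avgMeasurable
  exact topGapShellAt_nonneg F N θ.toStage9Params (datumOfRecord₁₃CoPH F N θ hP) g₀ os p _ k hk hζ0 hζm hP.zetaAbs hlo hhi t
    (fun s => integrable_chi_mul_dressedSlots_of_ppSelLive θ.toStage9Params E hsel hU hζm hζ0 hP.zetaAbs _ hD g₀ os hg t k s) s'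

/-- (R) **THE TWO-SIDED COLLAR SHELL NEVER EXCEEDS THE TOP-LETTERED TERM** (the gapped core is `≥ 0`; `0 ≤ ζ` is the provisos'); the `sh_le_left ∕ right` clause. [bookkeeping] -/
theorem topGapShellAt_le_topClassWeightAt_of_provisos (θ : Stage13HParams F N) (hP : θ.Provisos₁₃CoPH F N) (D : FiniteEpsData F (SU N)) (g₀ : ℕ → ℝ) (os : List (ULoop F))
    (p : B12.RunParams) (g : ℕ → ℝ) (k : ℕ) (θlo θm θhi t : ℝ) (s' : SeqOfRecord F θ.ν θ.τ9.M g p.K (k + 1)) :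
    topGapShellAt F N θ.toStage9Params D g₀ os p g k θlo θm θhi t s' ≤ topClassWeightAt F N θ.toStage9Params D g₀ os p g k θm t s' :=
  topGapShellAt_le_topClassWeightAt F N θ.toStage9Params D g₀ os p g k
    (fun p g k s Pl Ql RS U V' => zetaOfRecord_nonneg F N θ.ν θ.τ9.M hP.zetaUnity hP.zetaAbs p g k s Pl Ql RS U V') θlo θm θhi t s'

/-- ★★★ **(M1)-FREE NE7c, BOTH SIDES OF THE CUT, AT THE TOP-LETTERED TERMS OF THE TWO RUNS OF RECORD, ONE COMMON DEPTH** — see the file header.  Rows: the live-selector pin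
`hsel`, (H-ζ) `hζm`, the letter rows `0 ≤ ρ ≤ 1`, both tops' `0 ≤ ε`, the positivity of both tops; everything else (`0 ≤ ζ`, `Σ|ζ| ≤ 1`, `Σζ = 1`, (H-U), F3's (e1) at levels `kA`,
`kB`) is the provisos' ∕ the tree's.  NO anti-concentration, NO estimate of Bałaban's. [bookkeeping] -/
theorem exists_common_depth_topGapShell_le_of_liveSel (K₀ : ℕ) (θ : Stage13HParams F N) (hP : θ.Provisos₁₃CoPH F N) (g₀ : ℕ → ℝ) (os : List (ULoop F))
    (E : B12.RunParams → ℝ) (hsel : θ.ppSel = ppSelLiveOfRecord F N θ.ν θ.τ9 E (wOfRecord₉ F N θ.toStage9Params)) (hζm : ZetaMeasurable F N θ.ζ)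
    (K kA kB : ℕ) (hkA : kA + 1 = K₀ + K) (hkB : kB + 1 = K₀ + K + 1) {ρ : ℝ} (hρ0 : 0 ≤ ρ) (hρ1 : ρ ≤ 1)
    (hεA : 0 ≤ epsOfRecord θ.ν (histA₁₃ θ K₀ g₀ K) (kA + 1)) (hεB : 0 ≤ epsOfRecord θ.ν (histB₁₃ θ K₀ g₀ K) (kB + 1)) (n : ℕ) (t : ℝ) :
    ∃ i ∈ Finset.range (n + 1),
      ∑ s', topGapShellAt F N θ.toStage9Params (datumOfRecord₁₃CoPH F N θ hP) g₀ os (runA₁₃ F K₀ g₀ K) (histA₁₃ θ K₀ g₀ K) kA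
            (cutGrid θ.ν (histA₁₃ θ K₀ g₀ K) (kA + 1) ρ (i + 2)) (cutGrid θ.ν (histA₁₃ θ K₀ g₀ K) (kA + 1) ρ (i + 1)) (cutGrid θ.ν (histA₁₃ θ K₀ g₀ K) (kA + 1) ρ i) t s' ≤
          4 * (2 * (F.L : ℝ) ^ F.m) ^ 4 / (n + 1 : ℕ) *
            ∑ s, classWeightOfDatum₉ F N θ.toStage9Params (datumOfRecord₁₃CoPH F N θ hP) g₀ os (runA₁₃ F K₀ g₀ K) (histA₁₃ θ K₀ g₀ K) kA t s ∧
        ∑ s', topGapShellAt F N θ.toStage9Params (datumOfRecord₁₃CoPH F N θ hP) g₀ os (runB₁₃ F K₀ g₀ K) (histB₁₃ θ K₀ g₀ K) kB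
            (cutGrid θ.ν (histB₁₃ θ K₀ g₀ K) (kB + 1) ρ (i + 2)) (cutGrid θ.ν (histB₁₃ θ K₀ g₀ K) (kB + 1) ρ (i + 1)) (cutGrid θ.ν (histB₁₃ θ K₀ g₀ K) (kB + 1) ρ i) t s' ≤
          4 * (2 * (F.L : ℝ) ^ F.m) ^ 4 / (n + 1 : ℕ) *
            ∑ s, classWeightOfDatum₉ F N θ.toStage9Params (datumOfRecord₁₃CoPH F N θ hP) g₀ os (runB₁₃ F K₀ g₀ K) (histB₁₃ θ K₀ g₀ K) kB t s := by
  have hζ0 : ∀ p g k s Pl Ql RS U V', 0 ≤ θ.ζ p g k s Pl Ql RS U V' :=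
    fun p g k s Pl Ql RS U V' => zetaOfRecord_nonneg F N θ.ν θ.τ9.M hP.zetaUnity hP.zetaAbs p g k s Pl Ql RS U V'
  have hU : LocalBgMeasurable F N θ.ν := localBgMeasurable F N θ.ν
  have hD : (datumOfRecord₁₃CoPH F N θ hP).AvgMeasurable := (isPrintedAveraged_datumOfRecord₁₃CoPH F N θ hP).avgMeasurable
  have hkA' : kA + 1 = (runA₁₃ F K₀ g₀ K).K := by rw [YMDAG.UVSplit.runA₁₃_K]; exact hkA
  have hkB' : kB + 1 = (runB₁₃ F K₀ g₀ K).K := by rw [YMDAG.UVSplit.runB₁₃_K]; exact hkB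
  exact exists_common_depth_topGapShell_le F N θ.toStage9Params (datumOfRecord₁₃CoPH F N θ hP) g₀ os (runA₁₃ F K₀ g₀ K) (histA₁₃ θ K₀ g₀ K) kA hkA'
    (runB₁₃ F K₀ g₀ K) (histB₁₃ θ K₀ g₀ K) kB hkB' hζ0 hζm hP.zetaAbs hP.zetaUnity hεA hεB hρ0 hρ1 n t
    (fun s => integrable_chi_mul_dressedSlots_of_ppSelLive θ.toStage9Params E hsel hU hζm hζ0 hP.zetaAbs _ hD g₀ os (histA₁₃_zero θ K₀ g₀ K) t kA s)
    (fun s => integrable_chi_mul_dressedSlots_of_ppSelLive θ.toStage9Params E hsel hU hζm hζ0 hP.zetaAbs _ hD g₀ os (histB₁₃_zero θ K₀ g₀ K) t kB s)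

/-- ★★★ **NE7c's OUTPUT INEQUALITIES, BOTH SIDES OF THE CUT, FOR THE TOP-LETTERED TERMS OF RECORD AT THE SELECTED COMMON DEPTH, IN THE SHAPE `Σ sh ≤ Wsh · Σ A`**: on the
live-selector line SOME common `i ≤ n` has, for BOTH runs of record, `Σ_{s′} gapShell(θ_{i+2}, θ_{i+1}, θ_i)(s′) ≤ (4(2L^m)⁴∕(n+1)) · Σ_{s′} topClassWeight^{θ_{i+1}}(s′)` — the shells are
RELATIVE TO THE TOP-LETTERED TERMS THEMSELVES at the selected middle letter (both sums are the run's partition function, T3's E1∕E2).  With `Σ_K 1∕(n_K+1) < ∞` these are the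
`left ∕ right` fields of `T4IndicatorShell.ShellWeightBound` for a top-lettered reading with TWO-SIDED collar shells; rows `hsel` + (H-ζ) + signs; (M1)-FREE. [bookkeeping] -/
theorem exists_common_depth_topGapShell_le_topClassWeight_of_liveSel (K₀ : ℕ) (θ : Stage13HParams F N) (hP : θ.Provisos₁₃CoPH F N) (g₀ : ℕ → ℝ)
    (os : List (ULoop F)) (E : B12.RunParams → ℝ) (hsel : θ.ppSel = ppSelLiveOfRecord F N θ.ν θ.τ9 E (wOfRecord₉ F N θ.toStage9Params)) (hζm : ZetaMeasurable F N θ.ζ)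
    (K kA kB : ℕ) (hkA : kA + 1 = K₀ + K) (hkB : kB + 1 = K₀ + K + 1) {ρ : ℝ} (hρ0 : 0 ≤ ρ) (hρ1 : ρ ≤ 1)
    (hεA : 0 ≤ epsOfRecord θ.ν (histA₁₃ θ K₀ g₀ K) (kA + 1)) (hεB : 0 ≤ epsOfRecord θ.ν (histB₁₃ θ K₀ g₀ K) (kB + 1)) (n : ℕ) (t : ℝ) :
    ∃ i ∈ Finset.range (n + 1),
      ∑ s', topGapShellAt F N θ.toStage9Params (datumOfRecord₁₃CoPH F N θ hP) g₀ os (runA₁₃ F K₀ g₀ K) (histA₁₃ θ K₀ g₀ K) kA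
            (cutGrid θ.ν (histA₁₃ θ K₀ g₀ K) (kA + 1) ρ (i + 2)) (cutGrid θ.ν (histA₁₃ θ K₀ g₀ K) (kA + 1) ρ (i + 1)) (cutGrid θ.ν (histA₁₃ θ K₀ g₀ K) (kA + 1) ρ i) t s' ≤
          4 * (2 * (F.L : ℝ) ^ F.m) ^ 4 / (n + 1 : ℕ) *
            ∑ s', topClassWeightAt F N θ.toStage9Params (datumOfRecord₁₃CoPH F N θ hP) g₀ os (runA₁₃ F K₀ g₀ K) (histA₁₃ θ K₀ g₀ K) kA
              (cutGrid θ.ν (histA₁₃ θ K₀ g₀ K) (kA + 1) ρ (i + 1)) t s' ∧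
        ∑ s', topGapShellAt F N θ.toStage9Params (datumOfRecord₁₃CoPH F N θ hP) g₀ os (runB₁₃ F K₀ g₀ K) (histB₁₃ θ K₀ g₀ K) kB
            (cutGrid θ.ν (histB₁₃ θ K₀ g₀ K) (kB + 1) ρ (i + 2)) (cutGrid θ.ν (histB₁₃ θ K₀ g₀ K) (kB + 1) ρ (i + 1)) (cutGrid θ.ν (histB₁₃ θ K₀ g₀ K) (kB + 1) ρ i) t s' ≤
          4 * (2 * (F.L : ℝ) ^ F.m) ^ 4 / (n + 1 : ℕ) *
            ∑ s', topClassWeightAt F N θ.toStage9Params (datumOfRecord₁₃CoPH F N θ hP) g₀ os (runB₁₃ F K₀ g₀ K) (histB₁₃ θ K₀ g₀ K) kB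
              (cutGrid θ.ν (histB₁₃ θ K₀ g₀ K) (kB + 1) ρ (i + 1)) t s' := by
  have hζ0 : ∀ p g k s Pl Ql RS U V', 0 ≤ θ.ζ p g k s Pl Ql RS U V' :=
    fun p g k s Pl Ql RS U V' => zetaOfRecord_nonneg F N θ.ν θ.τ9.M hP.zetaUnity hP.zetaAbs p g k s Pl Ql RS U V'
  have hU : LocalBgMeasurable F N θ.ν := localBgMeasurable F N θ.ν
  have hkA' : kA + 1 = (runA₁₃ F K₀ g₀ K).K := by rw [YMDAG.UVSplit.runA₁₃_K]; exact hkA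
  have hkB' : kB + 1 = (runB₁₃ F K₀ g₀ K).K := by rw [YMDAG.UVSplit.runB₁₃_K]; exact hkB
  -- E1 ∕ E2: the level-`k` partition sums and the top-lettered sums are all the runs' partition functions
  have hEA := sum_classWeightOfDatum₉_datumOfRecord₁₃CoPH_eq_schemeZ_of_ppSelLive θ hP E hsel hU hζm hζ0 g₀ os
    (histA₁₃_zero θ K₀ g₀ K) t kA (by rw [← hkA']; exact Nat.le_succ kA)
  have hEB := sum_classWeightOfDatum₉_datumOfRecord₁₃CoPH_eq_schemeZ_of_ppSelLive θ hP E hsel hU hζm hζ0 g₀ os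
    (histB₁₃_zero θ K₀ g₀ K) t kB (by rw [← hkB']; exact Nat.le_succ kB)
  obtain ⟨i, hi, hA, hB⟩ := exists_common_depth_topGapShell_le_of_liveSel K₀ θ hP g₀ os E hsel hζm K kA kB hkA hkB hρ0 hρ1 hεA hεB n t
  have eA : ∑ s, classWeightOfDatum₉ F N θ.toStage9Params (datumOfRecord₁₃CoPH F N θ hP) g₀ os (runA₁₃ F K₀ g₀ K) (histA₁₃ θ K₀ g₀ K) kA t s =
      ∑ s', topClassWeightAt F N θ.toStage9Params (datumOfRecord₁₃CoPH F N θ hP) g₀ os (runA₁₃ F K₀ g₀ K) (histA₁₃ θ K₀ g₀ K) kA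
        (cutGrid θ.ν (histA₁₃ θ K₀ g₀ K) (kA + 1) ρ (i + 1)) t s' :=
    hEA.trans (sum_topClassWeightAt_runA_eq_schemeZ_of_liveSel K₀ θ hP g₀ os E hsel hζm K kA hkA (cutGrid θ.ν (histA₁₃ θ K₀ g₀ K) (kA + 1) ρ (i + 1)) t).symm
  have eB : ∑ s, classWeightOfDatum₉ F N θ.toStage9Params (datumOfRecord₁₃CoPH F N θ hP) g₀ os (runB₁₃ F K₀ g₀ K) (histB₁₃ θ K₀ g₀ K) kB t s =
      ∑ s', topClassWeightAt F N θ.toStage9Params (datumOfRecord₁₃CoPH F N θ hP) g₀ os (runB₁₃ F K₀ g₀ K) (histB₁₃ θ K₀ g₀ K) kB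
        (cutGrid θ.ν (histB₁₃ θ K₀ g₀ K) (kB + 1) ρ (i + 1)) t s' :=
    hEB.trans (sum_topClassWeightAt_runB_eq_schemeZ_of_liveSel K₀ θ hP g₀ os E hsel hζm K kB hkB (cutGrid θ.ν (histB₁₃ θ K₀ g₀ K) (kB + 1) ρ (i + 1)) t).symm
  refine ⟨i, hi, ?_, ?_⟩
  · rw [← eA]; exact hA
  · rw [← eB]; exact hB

end Record

end Summit.QuantumFields.YangMills.Theorems.N21ShellSplitOfRecord13CoPH

end
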